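import Mathlib
import Literature.NumberTheory.LFunctions.Zhang2022.Section17R1PrimeBulkTail
import HarnessLib

/-!
# Zhang (2022) §17.u021, remainder `R₁`, piece M2L-p BULK: the `D⁴`-truncation tail summed over the
# outer weights (blueprint Step D3, the two box re-indexings)

Topic `Literature/NumberTheory/LFunctions/Zhang2022` (Landau–Siegel audit tree; verdict-neutral).
Y. Zhang, *Discrete mean estimates and the Landau–Siegel zero*, arXiv:2211.02515v1 (2022)
[Zhang2022LandauSiegel] — **an unrefereed manuscript under adjudication**; nothing here asserts or denies
its Theorems 1–2. §17 p. 98 (u021; no bound in print). Piece M2L-p BULK of the sub-leaf `R₁` (WP16 leaf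
h17_9; blueprint `wp16/zl-w16-p3/R1-BULK-PLAN.md`, Step D3): with `T(q₂,p) = Σ_{a′∣q₂, D⁴<pa′}
|ν(pa′)|²τ₂(q₂/a′)` (the tail term of `norm_nuOneStar_prime_arg_le`) and `K₄ = Σ_{1≤n<N} τ₂(n)²/n`,

  `Σ_{1≤l<N} τ₂(l)/l Σ_{l=q₁q₂} τ₂(q₁) Σ_{p∈P} T(q₂,p)/p ≤ K₄² · log₂X · Σ_{D⁴<n≤X} |ν(n)|²τ₂(n)/n`

for every finite set `P` of primes with `pa′ ≤ X` (`a′ < N`): the re-indexings `(l; q₁,q₂) → box`,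
`τ₂(q₁q₂) ≤ τ₂(q₁)τ₂(q₂)`, `(q₂; a′, r) → box`, and the core count `Section17R1PrimeBulkTail.
sum_tau_div_sum_prime_le`. Theorems only; axioms standard.

## References

* Y. Zhang, arXiv:2211.02515v1 (2022), §17 p. 98 (u021). [cite: Zhang2022LandauSiegel, §17 u021 p.98]
-/

noncomputable section

open Complex Real Finset ArithmeticFunction
open Literature.NumberTheory.LFunctions.Zhang2022.Skeleton
open Literature.NumberTheory.LFunctions.Zhang2022.Typed.Section17
open Literature.NumberTheory.LFunctions.Zhang2022.MeanSquareMajorant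

namespace Literature.NumberTheory.LFunctions.Zhang2022.Phi3Eval

variable {D : ℕ} (χ : DirichletCharacter ℂ D)

/-- Swapping the `p`- and `a`-sums in the tail block and passing to the antidiagonal of `q₂`:
`τ₂(q₂)/q₂ · Σ_{p∈P} T(q₂,p)/p = Σ_{q₂ = ar} τ₂(ar)/(ar)·τ₂(r)·Σ_{p∈P, D⁴<pa} |ν(pa)|²/p`.
[cite: Zhang2022LandauSiegel, §17 u021 p.98] -/
theorem tail_block_eq_antidiag (P : Finset ℕ) (q₂ : ℕ) :
    tau 2 q₂ / q₂ * ∑ p ∈ P, (∑ a ∈ q₂.divisors with D ^ 4 < p * a,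
        ‖nu χ (p * a)‖ ^ 2 * tau 2 (q₂ / a)) / p =
      ∑ x ∈ q₂.divisorsAntidiagonal, tau 2 (x.1 * x.2) / ((x.1 * x.2 : ℕ) : ℝ) *
        (tau 2 x.2 * ∑ p ∈ P with D ^ 4 < p * x.1, ‖nu χ (p * x.1)‖ ^ 2 / p) := by
  classical
  -- swap `p` and `a`
  have hswap : ∑ p ∈ P, (∑ a ∈ q₂.divisors with D ^ 4 < p * a,
      ‖nu χ (p * a)‖ ^ 2 * tau 2 (q₂ / a)) / p =
      ∑ a ∈ q₂.divisors, tau 2 (q₂ / a) * ∑ p ∈ P with D ^ 4 < p * a, ‖nu χ (p * a)‖ ^ 2 / p := by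
    have h1 : ∀ p ∈ P, (∑ a ∈ q₂.divisors with D ^ 4 < p * a,
        ‖nu χ (p * a)‖ ^ 2 * tau 2 (q₂ / a)) / p =
        ∑ a ∈ q₂.divisors, if D ^ 4 < p * a then tau 2 (q₂ / a) * (‖nu χ (p * a)‖ ^ 2 / p) else 0 := by
      intro p _
      rw [Finset.sum_filter, Finset.sum_div]
      refine Finset.sum_congr rfl fun a _ => ?_
      split_ifs <;> ring
    rw [Finset.sum_congr rfl h1, Finset.sum_comm]
    refine Finset.sum_congr rfl fun a _ => ?_
    rw [Finset.sum_filter, Finset.mul_sum]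
    refine Finset.sum_congr rfl fun p _ => ?_
    split_ifs <;> ring
  rw [hswap, Finset.mul_sum,
    ← Nat.sum_divisorsAntidiagonal fun a b => tau 2 q₂ / q₂ *
      (tau 2 b * ∑ p ∈ P with D ^ 4 < p * a, ‖nu χ (p * a)‖ ^ 2 / p)]
  refine Finset.sum_congr rfl fun x hx => ?_
  rw [(Nat.mem_divisorsAntidiagonal.1 hx).1]

/-- **The summed truncation tail (blueprint Step D3)**: with `K₄ = Σ_{1≤n<N} τ₂(n)²/n` and a finite
set `P` of primes with `pa′ ≤ X` for `a′ < N`,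
`Σ_{1≤l<N} τ₂(l)/l Σ_{l=q₁q₂} τ₂(q₁) Σ_{p∈P} (1/p) Σ_{a′∣q₂, D⁴<pa′} |ν(pa′)|²τ₂(q₂/a′)
  ≤ K₄² · log₂X · Σ_{D⁴<n≤X} |ν(n)|²τ₂(n)/n`. [cite: Zhang2022LandauSiegel, §17 u021 p.98] -/
theorem bulk_tail_sum_le (P : Finset ℕ) (hP : ∀ p ∈ P, p.Prime) (N X : ℕ)
    (hX : ∀ p ∈ P, ∀ a ∈ Finset.Ico 1 N, p * a ≤ X) :
    ∑ l ∈ Finset.Ico 1 N, tau 2 l / l * ∑ q ∈ l.divisorsAntidiagonal, tau 2 q.1 *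
        ∑ p ∈ P, (∑ a ∈ q.2.divisors with D ^ 4 < p * a, ‖nu χ (p * a)‖ ^ 2 * tau 2 (q.2 / a)) / p ≤
      (∑ n ∈ Finset.Ico 1 N, tau 2 n ^ 2 / n) ^ 2 * ((Nat.log 2 X : ℝ) *
        ∑ n ∈ Finset.Ioc (D ^ 4) X, ‖nu χ n‖ ^ 2 * tau 2 n / n) := by
  classical
  set K₄ : ℝ := ∑ n ∈ Finset.Ico 1 N, tau 2 n ^ 2 / n with hK₄
  set Tq : ℕ → ℝ := fun q₂ =>
    ∑ p ∈ P, (∑ a ∈ q₂.divisors with D ^ 4 < p * a, ‖nu χ (p * a)‖ ^ 2 * tau 2 (q₂ / a)) / p with hTq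
  set Bp : ℕ → ℝ := fun a => ∑ p ∈ P with D ^ 4 < p * a, ‖nu χ (p * a)‖ ^ 2 / p with hBp
  have hTq0 : ∀ q₂, 0 ≤ Tq q₂ := fun q₂ => Finset.sum_nonneg fun p _ => div_nonneg
    (Finset.sum_nonneg fun a _ => mul_nonneg (by positivity) (tau_nonneg _ _)) (Nat.cast_nonneg p)
  have hBp0 : ∀ a, 0 ≤ Bp a := fun a => Finset.sum_nonneg fun p _ => by positivity
  have hK₄0 : 0 ≤ K₄ := Finset.sum_nonneg fun n _ => div_nonneg (by positivity) (Nat.cast_nonneg n)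
  -- (a) `(l; q₁, q₂) → box`
  have ha : ∑ l ∈ Finset.Ico 1 N, tau 2 l / l * ∑ q ∈ l.divisorsAntidiagonal, tau 2 q.1 * Tq q.2 ≤
      ∑ q₁ ∈ Finset.Ico 1 N, ∑ q₂ ∈ Finset.Ico 1 N, tau 2 q₁ ^ 2 / q₁ * (tau 2 q₂ / q₂ * Tq q₂) := by
    have h1 : ∑ l ∈ Finset.Ico 1 N, tau 2 l / l * ∑ q ∈ l.divisorsAntidiagonal, tau 2 q.1 * Tq q.2 =
        ∑ l ∈ Finset.Ico 1 N, ∑ q ∈ l.divisorsAntidiagonal,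
          tau 2 (q.1 * q.2) / ((q.1 * q.2 : ℕ) : ℝ) * (tau 2 q.1 * Tq q.2) := by
      refine Finset.sum_congr rfl fun l _ => ?_
      rw [Finset.mul_sum]
      refine Finset.sum_congr rfl fun q hq => ?_
      rw [(Nat.mem_divisorsAntidiagonal.1 hq).1]
    rw [h1]
    refine (sum_Ico_sum_antidiag_le N _ fun q => mul_nonneg (div_nonneg (tau_nonneg _ _)
      (Nat.cast_nonneg _)) (mul_nonneg (tau_nonneg _ _) (hTq0 _))).trans ?_
    refine Finset.sum_le_sum fun q₁ hq₁ => Finset.sum_le_sum fun q₂ hq₂ => ?_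
    have hq₁0 : (0 : ℝ) < q₁ := by have := (Finset.mem_Ico.1 hq₁).1; exact_mod_cast this
    have hq₂0 : (0 : ℝ) < q₂ := by have := (Finset.mem_Ico.1 hq₂).1; exact_mod_cast this
    have hτ : tau 2 (q₁ * q₂) ≤ tau 2 q₁ * tau 2 q₂ := tau_mul_le 2 q₁ q₂
    have hτ1 := tau_nonneg 2 q₁
    have e1 : tau 2 (q₁ * q₂) / ((q₁ * q₂ : ℕ) : ℝ) * (tau 2 q₁ * Tq q₂) =
        (tau 2 (q₁ * q₂) * tau 2 q₁ * Tq q₂) / (q₁ * q₂) := by push_cast; ring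
    have e2 : tau 2 q₁ ^ 2 / q₁ * (tau 2 q₂ / q₂ * Tq q₂) =
        (tau 2 q₁ * tau 2 q₂ * tau 2 q₁ * Tq q₂) / (q₁ * q₂) := by
      field_simp
    rw [e1, e2]
    exact div_le_div_of_nonneg_right (mul_le_mul_of_nonneg_right
      (mul_le_mul_of_nonneg_right hτ hτ1) (hTq0 _)) (by positivity)
  -- (b) `(q₂; a, r) → box`
  have hb : ∑ q₂ ∈ Finset.Ico 1 N, tau 2 q₂ / q₂ * Tq q₂ ≤
      K₄ * ∑ a ∈ Finset.Ico 1 N, tau 2 a / a * Bp a := by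
    have h1 : ∑ q₂ ∈ Finset.Ico 1 N, tau 2 q₂ / q₂ * Tq q₂ =
        ∑ q₂ ∈ Finset.Ico 1 N, ∑ x ∈ q₂.divisorsAntidiagonal,
          tau 2 (x.1 * x.2) / ((x.1 * x.2 : ℕ) : ℝ) * (tau 2 x.2 * Bp x.1) := by
      exact Finset.sum_congr rfl fun q₂ _ => tail_block_eq_antidiag χ P q₂
    rw [h1]
    refine (sum_Ico_sum_antidiag_le N _ fun x => mul_nonneg (div_nonneg (tau_nonneg _ _)
      (Nat.cast_nonneg _)) (mul_nonneg (tau_nonneg _ _) (hBp0 _))).trans ?_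
    -- bound `τ₂(ar) ≤ τ₂(a)τ₂(r)` and factor
    calc ∑ a ∈ Finset.Ico 1 N, ∑ r ∈ Finset.Ico 1 N,
          tau 2 (a * r) / ((a * r : ℕ) : ℝ) * (tau 2 r * Bp a)
        ≤ ∑ a ∈ Finset.Ico 1 N, ∑ r ∈ Finset.Ico 1 N, (tau 2 r ^ 2 / r) * (tau 2 a / a * Bp a) := by
          refine Finset.sum_le_sum fun a ha' => Finset.sum_le_sum fun r hr => ?_
          have ha0 : (0 : ℝ) < a := by have := (Finset.mem_Ico.1 ha').1; exact_mod_cast this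
          have hr0 : (0 : ℝ) < r := by have := (Finset.mem_Ico.1 hr).1; exact_mod_cast this
          have hτ : tau 2 (a * r) ≤ tau 2 a * tau 2 r := tau_mul_le 2 a r
          have hτr := tau_nonneg 2 r
          have e1 : tau 2 (a * r) / ((a * r : ℕ) : ℝ) * (tau 2 r * Bp a) =
              (tau 2 (a * r) * tau 2 r * Bp a) / (a * r) := by push_cast; ring
          have e2 : tau 2 r ^ 2 / r * (tau 2 a / a * Bp a) =
              (tau 2 a * tau 2 r * tau 2 r * Bp a) / (a * r) := by field_simp
          rw [e1, e2]
          exact div_le_div_of_nonneg_right (mul_le_mul_of_nonneg_right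
            (mul_le_mul_of_nonneg_right hτ hτr) (hBp0 _)) (by positivity)
      _ = K₄ * ∑ a ∈ Finset.Ico 1 N, tau 2 a / a * Bp a := by
          rw [Finset.mul_sum]
          refine Finset.sum_congr rfl fun a _ => ?_
          rw [← Finset.sum_mul, hK₄]
  -- (c) the core count
  have hc := sum_tau_div_sum_prime_le χ P hP N X hX
  -- assemble
  calc ∑ l ∈ Finset.Ico 1 N, tau 2 l / l * ∑ q ∈ l.divisorsAntidiagonal, tau 2 q.1 * Tq q.2
      ≤ ∑ q₁ ∈ Finset.Ico 1 N, ∑ q₂ ∈ Finset.Ico 1 N, tau 2 q₁ ^ 2 / q₁ * (tau 2 q₂ / q₂ * Tq q₂) := ha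
    _ = K₄ * ∑ q₂ ∈ Finset.Ico 1 N, tau 2 q₂ / q₂ * Tq q₂ := by
        rw [hK₄, Finset.sum_mul]
        refine Finset.sum_congr rfl fun q₁ _ => ?_
        rw [Finset.mul_sum]
    _ ≤ K₄ * (K₄ * ∑ a ∈ Finset.Ico 1 N, tau 2 a / a * Bp a) := mul_le_mul_of_nonneg_left hb hK₄0
    _ ≤ K₄ * (K₄ * ((Nat.log 2 X : ℝ) * ∑ n ∈ Finset.Ioc (D ^ 4) X, ‖nu χ n‖ ^ 2 * tau 2 n / n)) :=
        mul_le_mul_of_nonneg_left (mul_le_mul_of_nonneg_left hc hK₄0) hK₄0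
    _ = _ := by rw [hK₄]; ring

end Literature.NumberTheory.LFunctions.Zhang2022.Phi3Eval
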